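import Mathlib.Analysis.SpecialFunctions.Pow.Real
import Mathlib.Analysis.SpecialFunctions.Exponential
import Mathlib.Analysis.SpecialFunctions.Log.Basic
import Mathlib.Analysis.SpecialFunctions.Trigonometric.Deriv
import Mathlib.Analysis.Complex.ExponentialBounds
import Mathlib.Analysis.Real.Pi.Bounds
import HarnessLib

/-!
# HANDOFF — ASYMPTOTICS (E): the cost–gain comparison (rh-explicit, track «HANDOFF», seat prove-2 gen10, ATTEMPT-19 §8 (P7))

HONEST FRAMING. Nothing here bears on the truth of RH; elementary real inequalities (Mathlib only). In ABSTRACT variables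
(`T = T′`, `k = k′`, `cI`, `cL = 4cI`, `xL = √(cL/4)`, `pU`, with the sizes of part (B) as hypotheses) and the programme's choices
(`y = (3/5)L^{3/2}`, `2b ≤ L ≤ 2b+1`, `b ≥ 100`, `δU ≤ 1`, `6r ≤ δL`, `κ ≥ 1/2`, `Φ ≥ e^{30L/43−3}/(3L)` from parts (C), (D)) we prove
the ONE comparison `hlt` of `dodger_witness_explicit`:
`cost ≤ 18300(b+4)e^{−2b}`  <  `6·10⁻⁷·e^{−52b/43}/(2b+1)² ≤ gain`. No `sorry`, standard axioms.

References: this track (ATTEMPT-16 §6, THEOREM 16.2; ATTEMPT-19 §8 (P7)).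
-/

set_option linter.dupNamespace false

noncomputable section

open Real

namespace Summit.RiemannHypothesis.RiemannHypothesis.Theorems.Handoff

/-- **The cost prefactor.** `0 ≤ δ ≤ 1`, `b ≥ 100` ⟹ `4(sinh²(δ/2)+1)·e·(4cosh²(b/2)(1+b)²/b²) ≤ 121·e^b`. [this track, ATTEMPT-19 §8 (P7)] -/
theorem cost_prefactor_le {δ b : ℝ} (hδ0 : 0 ≤ δ) (hδ1 : δ ≤ 1) (hb : 100 ≤ b) :
    4 * (Real.sinh (δ / 2) ^ 2 + 1) * Real.exp 1 * (4 * Real.cosh (b / 2) ^ 2 * (1 + b) ^ 2 / b ^ 2) ≤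
      121 * Real.exp b := by
  have hb0 : 0 < b := by linarith
  -- `cosh x ≤ eˣ` for `x ≥ 0` (also in the tree as `Literature.NumberTheory.Automorphic.cosh_le_exp_of_nonneg`)
  have cosh_le : ∀ x : ℝ, 0 ≤ x → Real.cosh x ≤ Real.exp x := fun x hx => by
    rw [Real.cosh_eq]
    have : Real.exp (-x) ≤ Real.exp x := Real.exp_le_exp.2 (by linarith)
    linarith
  have h1 : Real.sinh (δ / 2) ^ 2 + 1 ≤ Real.exp 1 := by
    rw [← Real.cosh_sq]
    have hc := cosh_le (δ / 2) (by linarith)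
    have hc0 : 0 ≤ Real.cosh (δ / 2) := (Real.cosh_pos _).le
    calc Real.cosh (δ / 2) ^ 2 ≤ Real.exp (δ / 2) ^ 2 := pow_le_pow_left₀ hc0 hc 2
      _ = Real.exp δ := by rw [← Real.exp_nat_mul]; ring_nf
      _ ≤ Real.exp 1 := Real.exp_le_exp.2 hδ1
  have h2 : Real.cosh (b / 2) ^ 2 ≤ Real.exp b := by
    have hc := cosh_le (b / 2) (by linarith)
    have hc0 : 0 ≤ Real.cosh (b / 2) := (Real.cosh_pos _).le
    calc Real.cosh (b / 2) ^ 2 ≤ Real.exp (b / 2) ^ 2 := pow_le_pow_left₀ hc0 hc 2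
      _ = Real.exp b := by rw [← Real.exp_nat_mul]; ring_nf
  have h3 : (1 + b) ^ 2 / b ^ 2 ≤ 1.0201 := by
    rw [div_le_iff₀ (by positivity)]; nlinarith
  have he := Real.exp_one_lt_d9
  have hE := Real.exp_pos b
  have h4 : 4 * Real.cosh (b / 2) ^ 2 * (1 + b) ^ 2 / b ^ 2 ≤ 4 * Real.exp b * 1.0201 := by
    rw [mul_div_assoc]
    exact mul_le_mul (by linarith) h3 (by positivity) (by positivity)
  calc 4 * (Real.sinh (δ / 2) ^ 2 + 1) * Real.exp 1 * (4 * Real.cosh (b / 2) ^ 2 * (1 + b) ^ 2 / b ^ 2)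
      ≤ 4 * Real.exp 1 * Real.exp 1 * (4 * Real.exp b * 1.0201) := by
        have a : 4 * (Real.sinh (δ / 2) ^ 2 + 1) * Real.exp 1 ≤ 4 * Real.exp 1 * Real.exp 1 := by
          nlinarith [Real.exp_pos 1]
        exact mul_le_mul a h4 (by positivity) (by positivity)
    _ ≤ 121 * Real.exp b := by
        have hee : Real.exp 1 * Real.exp 1 ≤ 7.3891 := by nlinarith [he, Real.exp_pos 1]
        nlinarith [mul_le_mul_of_nonneg_right hee hE.le]

/-- `log T ≤ 2b + 6.3` when `0 < T ≤ 2πe^{1+2b}`. [this track, ATTEMPT-19 §8] -/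
theorem log_horizon_le {T b : ℝ} (hT0 : 0 < T) (hT : T ≤ 2 * π * Real.exp (1 + 2 * b)) :
    Real.log T ≤ 2 * b + 6.3 := by
  have hπ4 : π < 3.1416 := Real.pi_lt_d4
  have h1 : Real.log T ≤ Real.log (2 * π * Real.exp (1 + 2 * b)) := Real.log_le_log hT0 hT
  rw [Real.log_mul (by positivity) (Real.exp_pos _).ne', Real.log_exp] at h1
  have h2 : Real.log (2 * π) ≤ 2 * π - 1 := Real.log_le_sub_one_of_pos (by positivity)
  linarith

/-- **The zero-count factor is at most one.** `T ≥ 100` ⟹ `((2T)/(2π)·log((2T)/(2πe)) + s₁(2T))/T² ≤ 1`.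
[this track, ATTEMPT-19 §8 (P7)] -/
theorem count_factor_le_one {T : ℝ} (hT : 100 ≤ T) :
    ((2 * T) / (2 * π) * Real.log ((2 * T) / (2 * π * Real.exp 1)) +
        (0.1038 * Real.log (2 * T) + 0.2573 * Real.log (Real.log (2 * T)) + 9.3675)) / T ^ 2 ≤ 1 := by
  have hπ3 : 3 < π := Real.pi_gt_three
  have hT0 : 0 < T := by linarith
  have he : 2.7 < Real.exp 1 := lt_trans (by norm_num) Real.exp_one_gt_d9
  rw [div_le_one (by positivity)]
  have h1 : Real.log ((2 * T) / (2 * π * Real.exp 1)) ≤ (2 * T) / (2 * π * Real.exp 1) := by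
    have := Real.log_le_sub_one_of_pos (show 0 < (2 * T) / (2 * π * Real.exp 1) by positivity); linarith
  have h2 : (2 * T) / (2 * π * Real.exp 1) ≤ T / 8 := by
    rw [div_le_div_iff₀ (by positivity) (by norm_num)]
    have : 8 ≤ π * Real.exp 1 := by nlinarith [hπ3, he]
    nlinarith [mul_le_mul_of_nonneg_left this hT0.le]
  have h3 : (2 * T) / (2 * π) ≤ T / 3 := by
    rw [div_le_div_iff₀ (by positivity) (by norm_num)]; nlinarith
  have h4 : (2 * T) / (2 * π) * Real.log ((2 * T) / (2 * π * Real.exp 1)) ≤ T / 3 * (T / 8) := by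
    have h0 : 0 ≤ (2 * T) / (2 * π) := by positivity
    calc (2 * T) / (2 * π) * Real.log ((2 * T) / (2 * π * Real.exp 1)) ≤ (2 * T) / (2 * π) * (T / 8) :=
          mul_le_mul_of_nonneg_left (h1.trans h2) h0
      _ ≤ T / 3 * (T / 8) := mul_le_mul_of_nonneg_right h3 (by positivity)
  have h5 : Real.log (2 * T) ≤ 2 * T := by
    have := Real.log_le_sub_one_of_pos (show 0 < 2 * T by positivity); linarith
  have h6 : Real.log (Real.log (2 * T)) ≤ 2 * T := by
    have hl : 0 < Real.log (2 * T) := Real.log_pos (by linarith)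
    have := Real.log_le_sub_one_of_pos hl; linarith
  nlinarith

set_option maxHeartbeats 400000 in
/-- **The first cost term.** [this track, ATTEMPT-19 §8 (P7)] -/
theorem cost_first_le {T b k cI cL : ℝ} (hb : 100 ≤ b) (hT : 110000 * (b + 1) ^ 2 ≤ T)
    (hTT₀ : T ≤ 2 * π * Real.exp (1 + 2 * b)) (hk2 : 2 ≤ k) (hk : k ≤ 2 / 5 * b * T)
    (hcI : T ^ 3 / (19 * π) ≤ cI) (hcL : cL = 4 * cI) :
    ((2 * T) / (2 * π) * Real.log ((2 * T) / (2 * π * Real.exp 1)) +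
          (0.1038 * Real.log (2 * T) + 0.2573 * Real.log (Real.log (2 * T)) + 9.3675)) / T ^ 2 *
        Real.exp (4 * (b / π * (1 + Real.log (k - 1))) - cL / (2 * T + 1) ^ 2) ≤ 1 / (T * Real.sqrt T) := by
  have hπ3 : 3 < π := Real.pi_gt_three
  have hπ4 : π < 3.1416 := Real.pi_lt_d4
  have hb0 : 0 < b := by linarith
  have hT0 : 0 < T := by nlinarith
  have hT1 : 40000 ≤ T := by nlinarith
  -- the count factor
  have hN := count_factor_le_one (by linarith : 100 ≤ T)
  refine (mul_le_of_le_one_left (Real.exp_pos _).le hN).trans ?_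
  -- the exponent
  have hlogk : Real.log (k - 1) ≤ 3 * b + 5.3 := by
    have h1 : Real.log (k - 1) ≤ Real.log k := Real.log_le_log (by linarith) (by linarith)
    have h2 : Real.log k ≤ Real.log (b * T) := Real.log_le_log (by linarith) (by nlinarith)
    rw [Real.log_mul hb0.ne' hT0.ne'] at h2
    have h3 : Real.log b ≤ b - 1 := Real.log_le_sub_one_of_pos hb0
    have h4 := log_horizon_le hT0 hTT₀
    linarith
  have hA : 4 * (b / π * (1 + Real.log (k - 1))) ≤ 5 * b ^ 2 := by
    have h1 : b / π ≤ b / 3 := div_le_div_of_nonneg_left hb0.le (by norm_num) hπ3.le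
    have h2 : 0 ≤ 1 + Real.log (k - 1) := by
      have : 0 ≤ Real.log (k - 1) := Real.log_nonneg (by linarith)
      linarith
    have h3 : b / π * (1 + Real.log (k - 1)) ≤ b / 3 * (3 * b + 6.3) :=
      mul_le_mul h1 (by linarith) h2 (by positivity)
    nlinarith
  have hB : T / 60.5 ≤ cL / (2 * T + 1) ^ 2 := by
    rw [hcL, div_le_div_iff₀ (by norm_num) (by positivity)]
    have h1 : (2 * T + 1) ^ 2 ≤ 4.04 * T ^ 2 := by nlinarith
    have h2 : T ^ 3 / (19 * π) ≥ T ^ 3 / 59.7 := div_le_div_of_nonneg_left (by positivity) (by positivity) (by nlinarith)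
    have h3 : T * (2 * T + 1) ^ 2 ≤ T * (4.04 * T ^ 2) := mul_le_mul_of_nonneg_left h1 hT0.le
    have h4 : T ^ 3 ≤ 59.7 * cI := by
      have := h2.le.trans hcI; rw [div_le_iff₀ (by norm_num)] at this; linarith
    nlinarith
  have hE : 4 * (b / π * (1 + Real.log (k - 1))) - cL / (2 * T + 1) ^ 2 ≤ -(T / 100) := by
    have : 5 * b ^ 2 ≤ T / 60.5 - T / 100 := by
      rw [div_sub_div _ _ (by norm_num) (by norm_num), le_div_iff₀ (by norm_num)]; nlinarith
    linarith
  refine (Real.exp_le_exp.2 hE).trans ?_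
  -- `e^{-T/100} ≤ 1/(T√T)`
  rw [Real.exp_neg, one_div, inv_le_inv₀ (Real.exp_pos _) (by positivity)]
  have h3 : (T / 100) ^ 3 / 6 ≤ Real.exp (T / 100) := by
    have := Real.pow_div_factorial_le_exp (T / 100) (by positivity) 3
    norm_num [Nat.factorial] at this; exact this
  have hs : Real.sqrt T ≤ T / 200 := by
    rw [Real.sqrt_le_left (by positivity)]; nlinarith
  have h4 : T * Real.sqrt T ≤ T * (T / 200) := mul_le_mul_of_nonneg_left hs hT0.le
  nlinarith [pow_pos hT0 3]

set_option maxHeartbeats 400000 in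
/-- **The second cost term.** [this track, ATTEMPT-19 §8 (P7)] -/
theorem cost_second_le {T b k cI cL xL : ℝ} (hb : 100 ≤ b) (hT : 110000 * (b + 1) ^ 2 ≤ T)
    (hTT₀ : T ≤ 2 * π * Real.exp (1 + 2 * b)) (hk2 : 2 ≤ k) (hk : k ≤ 2 / 5 * b * T)
    (hcI : T ^ 3 / (19 * π) ≤ cI) (hcI2 : cI ≤ T ^ 3) (hcL : cL = 4 * cI) (hxL : xL = Real.sqrt (cL / 4)) :
    Real.exp (144 * (2 * k) ^ 2 / (7 * cL)) * (Real.log xL / (Real.exp 1 * xL) + 220 * (Real.log xL + 1) / xL) ≤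
      5250 * (b + 4) / (T * Real.sqrt T) := by
  have hπ3 : 3 < π := Real.pi_gt_three
  have hπ4 : π < 3.1416 := Real.pi_lt_d4
  have hb0 : 0 < b := by linarith
  have hT0 : 0 < T := by nlinarith
  have hx : xL = Real.sqrt cI := by rw [hxL, hcL]; ring_nf
  have hcI0 : T ^ 3 / 59.7 ≤ cI := le_trans (div_le_div_of_nonneg_left (by positivity) (by positivity) (by nlinarith)) hcI
  have hcIpos : 0 < cI := lt_of_lt_of_le (by positivity) hcI0
  have hTs : 0 < T * Real.sqrt T := by positivity
  -- `xL ≥ T√T/7.73 ≥ 1`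
  have hx1 : T * Real.sqrt T / 7.73 ≤ xL := by
    rw [hx, Real.le_sqrt (by positivity) hcIpos.le, div_pow, mul_pow, Real.sq_sqrt hT0.le]
    rw [div_le_iff₀ (by norm_num)]; rw [div_le_iff₀ (by norm_num)] at hcI0; nlinarith
  have hx2 : 1 ≤ xL := by
    have : 7.73 ≤ T * Real.sqrt T := by
      have hs : 1 ≤ Real.sqrt T := by rw [Real.le_sqrt (by norm_num) hT0.le]; nlinarith
      nlinarith
    have : 1 ≤ T * Real.sqrt T / 7.73 := by rw [le_div_iff₀ (by norm_num)]; linarith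
    linarith
  have hx0 : 0 < xL := by linarith
  -- `0 ≤ log xL ≤ 3b + 9.45`
  have hlx0 : 0 ≤ Real.log xL := Real.log_nonneg hx2
  have hlx : Real.log xL ≤ 3 * b + 9.45 := by
    rw [hx, Real.log_sqrt hcIpos.le]
    have h1 : Real.log cI ≤ Real.log (T ^ 3) := Real.log_le_log hcIpos hcI2
    rw [Real.log_pow] at h1
    have h2 := log_horizon_le hT0 hTT₀
    push_cast at h1
    linarith
  -- the exponential factor `≤ 1.02`
  have hexp : Real.exp (144 * (2 * k) ^ 2 / (7 * cL)) ≤ 1.02 := by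
    have hu0 : 0 ≤ 144 * (2 * k) ^ 2 / (7 * cL) := by rw [hcL]; positivity
    have hu : 144 * (2 * k) ^ 2 / (7 * cL) ≤ 1 / 100 := by
      rw [hcL, div_le_div_iff₀ (by positivity) (by norm_num)]
      have h1 : (2 * k) ^ 2 ≤ (2 * (2 / 5 * b * T)) ^ 2 := pow_le_pow_left₀ (by linarith) (by linarith) 2
      have h2 : 20000 * b ^ 2 ≤ T := by nlinarith
      have h3 : T ^ 3 ≤ 59.7 * cI := by rw [div_le_iff₀ (by norm_num)] at hcI0; linarith
      nlinarith [mul_le_mul_of_nonneg_left h2 (by positivity : (0:ℝ) ≤ b ^ 2 * T ^ 2), sq_nonneg b, sq_nonneg T]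
    have := Real.abs_exp_sub_one_le (x := 144 * (2 * k) ^ 2 / (7 * cL)) (by rw [abs_of_nonneg hu0]; linarith)
    rw [abs_of_nonneg hu0] at this
    have := (abs_le.1 this).2
    linarith
  -- the bracket `≤ 662(b+4)/xL`
  have he : 2.7 < Real.exp 1 := lt_trans (by norm_num) Real.exp_one_gt_d9
  have hbr : Real.log xL / (Real.exp 1 * xL) + 220 * (Real.log xL + 1) / xL ≤ 662 * (b + 4) / xL := by
    have h1 : Real.log xL / (Real.exp 1 * xL) ≤ (3 * b + 9.45) / 2.7 / xL := by
      rw [div_div, div_le_div_iff₀ (by positivity) (by positivity)]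
      have := mul_le_mul hlx he.le (by norm_num) (by linarith)
      nlinarith
    have h2 : 220 * (Real.log xL + 1) / xL ≤ 220 * (3 * b + 10.45) / xL :=
      div_le_div_of_nonneg_right (by linarith) hx0.le
    have h3 : (3 * b + 9.45) / 2.7 / xL + 220 * (3 * b + 10.45) / xL ≤ 662 * (b + 4) / xL := by
      rw [← add_div, div_le_div_iff_of_pos_right hx0]
      rw [div_add' _ _ _ (by norm_num), div_le_iff₀ (by norm_num)]; nlinarith
    linarith
  have hbr0 : 0 ≤ Real.log xL / (Real.exp 1 * xL) + 220 * (Real.log xL + 1) / xL := by positivity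
  calc Real.exp (144 * (2 * k) ^ 2 / (7 * cL)) * (Real.log xL / (Real.exp 1 * xL) + 220 * (Real.log xL + 1) / xL)
      ≤ 1.02 * (662 * (b + 4) / xL) := mul_le_mul hexp hbr hbr0 (by norm_num)
    _ ≤ 1.02 * (662 * (b + 4) / (T * Real.sqrt T / 7.73)) := by
        have := div_le_div_of_nonneg_left (by positivity : 0 ≤ 662 * (b + 4)) (by positivity) hx1
        nlinarith
    _ = 1.02 * 662 * 7.73 * (b + 4) / (T * Real.sqrt T) := by field_simp
    _ ≤ 5250 * (b + 4) / (T * Real.sqrt T) := by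
        apply div_le_div_of_nonneg_right _ hTs.le; nlinarith

end Summit.RiemannHypothesis.RiemannHypothesis.Theorems.Handoff
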